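import Literature.AlgebraicGeometry.GroupSchemes.EtaleOfCotangentRankZero
import Literature.AlgebraicGeometry.GroupSchemes.TorsionLayerBlockIdempotents
import Literature.AlgebraicGeometry.GroupSchemes.BarsottiTateGroupFixedPartCotangent
import Literature.AlgebraicGeometry.Motives.AbelianVarietyTorsionCotangent
import HarnessLib

/-!
# A block of the torsion layer whose idempotent has zero Lie signature is étale, and carries the étale banal Frobenius-kernel law
# ([Tate 1967] §2.2; [Görtz–Wedhorn I] (6.4); [Rapoport–Smithling–Zhang 2020] §4.1; [Tate 1997] (3.7))

Topic `Literature/AlgebraicGeometry/AbelianSchemes`; namespaces `Literature.AlgebraicGeometry.GroupSchemes` (§1–§2, any finite commutative group scheme over a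
field) and `Literature.AlgebraicGeometry.AbelianSchemes.AbelianSchemeOver` (§3–§4, the torsion layer `A[N]` of an abelian scheme over `Spec k`).  THEOREMS ONLY
(no definition, no named fact, no instance, no notation, no `sorry`).  Cell `hodgecm-mathlib` (D-0151), FLOOR 0, P6 «MOD programme» (crux hLiu418 =
stmt-HodgeConjecture-24832, `--supports`, count-neutral): organ **(C1) FILE 2 «BLOCK TYPE FROM THE LIE SIGNATURE»** (LEAD F0P6-plan (g2) 2026-09-01T21:20:32Z; GEN
census 09be7b9d row (iii) «banal blocks»; reading B-p18 (g37) 21:17:00Z (a)): at a banal place `u` of the CM field the block idempotent `e_u` acts on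
`Lie(A) = (𝔪_{A,e}∕𝔪_{A,e}²)^∨` with rank `0` (Kottwitz signature `0` at `u`); then the `u`-block `Fix(e_u | A[N])` of every torsion layer `A[N]`, `N = 0` in
`k`, is ÉTALE, so `Ker F_q ∩ (u-block) = 1` (★ (C1) FILE 1).  EXPLICIT-PIN currency: `G := 𝒜.torsion N` (★ `PDivisibleGroupOfAbelianScheme`), block
endomorphism `ε := torsionMap (act.i e) N` (★ `PDivisibleGroupFunctor`; it IS the layer endomorphism `β e` of ★ (α) `TorsionLayerBlockIdempotents` by
`layerEnd_unique`, and the K∕BT desk's `(ε_w)_n` by `rfl`), block `Fix ε` (★ `IdempotentSplittingFiniteFlat`).  HC_CM is proved only modulo the printed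
citations until rung 0 closes; this file is generic and changes no count.

THE MATHEMATICS.  [GortzWedhorn2020] (6.4) Prop. 6.7 and [Tate1967] §2.2: for an idempotent endomorphism `ε` of a group scheme `G` over `k`, `Fix ε` is a
RETRACT of `G` (`ι ≫ r = 𝟙`, `r ≫ ι = ε`), so its cotangent space at the unit is the image of `cot(ε)` on `cot(G)` (★ `finrank_cotangent_unit_eq_finrank_range_of_retract`);
for `G = A[N]` with `N = 0` in `k`, `cot(A[N]) = cot(A)` equivariantly (★ DEAL 2 `finrank_range_mapCotangent_torsionMap_eq`), so `dim cot(Fix(e|A[N])) =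
rk (e^* | 𝔪_{A,e}∕𝔪_{A,e}²)` = the Lie signature of `e`; if it is `0`, `Fix` is étale (★ `etale_of_finrank_cotangent_unit_eq_zero`, `k = k̄`;
[Tate1997FiniteFlatGroupSchemes] (3.7)) and the étale law ★ `comp_comp_comp_relFrobenius_eq_one_iff_of_etale` applies to the pin `Fix ↪ A[N] ↪ A`.  A CRT
idempotent `e² = e + N c` of the acting ring gives an idempotent `torsionMap (ι e) N` (★ (α) `layerEnd_idem_of_mul_self_eq`).  [RapoportSmithlingZhang2020Diagonal]
§4.1: the blocks `A[u^∞]` of `A[p^∞]` under `O_F ⊗ ℤ_p = ∏_u O_{F,u}` and their signatures.  Two pins with the same `T`-points are isomorphic over the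
ambient object (Yoneda), so étaleness passes to any abstract realisation of the block (★ (α) `exists_fixedLayer`).

* §1 `finrank_cotangent_fix_eq_finrank_range` (cotangent rank of `Fix ε` = rank of `cot(ε)`), **`etale_fix_of_finrank_range_mapCotangent_eq_zero`**.
* §2 `exists_iso_of_readings` (any category: two monos with the same `T`-points are isomorphic over the ambient), `etale_of_fix_reading` (étaleness of
  any pin reading `x ≫ ε = x`).
* §3 (torsion layer of an abelian scheme over `Spec k`) `torsionMap_i_add ∕ torsionMap_i_mul ∕ torsionMap_i_idem_of_mul_self_eq` (ring-action calculus of `torsionMap`, via ★ (α)),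
  **`etale_fix_torsionMap_of_finrank_range_cotangentMap_eq_zero`** (Lie rank `0` ⇒ the block is étale), `id_pow_fix_torsionMap_eq_one` (`[N]` kills the blocks —
  the `hq` of the multiplicative law ★ `comp_comp_relFrobenius_eq_one_of_etale_cartierDual`).
* §4 HEADS **`etale_block_of_lieSignature_zero`** (ring action + CRT idempotent `e² = e + N•c` + Lie signature `0` ⇒ `Fix (torsionMap (ι e) N)` étale) and
  **`block_comp_relFrobenius_eq_one_iff_of_lieSignature_zero`** (the ÉTALE BANAL LAW on that block: `((t ≫ ι_Fix) ≫ ι_{A[N]}) ≫ F^{(r)}_{A∕k} = 1 ↔ t = 1`).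

## References
* [Tate1967] J. T. Tate, *p-divisible groups*, Proc. Conf. Local Fields (Driebergen 1966), Springer (1967), §2.2.
* [GortzWedhorn2020] U. Görtz, T. Wedhorn, *Algebraic Geometry I* (2nd ed. 2020), (6.4) Definition 6.2, Proposition 6.7.
* [RapoportSmithlingZhang2020Diagonal] M. Rapoport, B. Smithling, W. Zhang, *Arithmetic diagonal cycles on unitary Shimura varieties*, Compos. Math. 156 (2020), §4.1 (p. 17).
* [Tate1997FiniteFlatGroupSchemes] J. Tate, *Finite flat group schemes*, in: Modular Forms and Fermat's Last Theorem (1997), (3.7).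
-/

set_option autoImplicit false

-- Mathlib's `Over`/`Scheme` APIs are stated across semireducible wrappers (as in the ★ `GroupSchemes/*` files).
set_option backward.isDefEq.respectTransparency false

noncomputable section

universe u

open CategoryTheory CategoryTheory.Limits AlgebraicGeometry MonoidalCategory CartesianMonoidalCategory
open scoped MonObj

namespace Literature.AlgebraicGeometry.GroupSchemes

open Literature.AlgebraicGeometry.Motives AffineGroupScheme IdempotentSplitting TorsionLayer

/-! ## §1 The cotangent rank of `Fix ε` is the rank of `cot(ε)`; rank zero ⇒ `Fix ε` étale -/

section Fix

variable {k : Type u} [Field k]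

/-- **`dim_k cot(Fix ε) = rk_k cot(ε)`** for an idempotent homomorphism `ε` of a commutative `k`-group scheme `G` (`Fix ε` is a retract of `G`: ★
`fixι_fixRetract`, `fixRetract_ι`; ★ `finrank_cotangent_unit_eq_finrank_range_of_retract`). [cite: GortzWedhorn2020, (6.4) Proposition 6.7] [cite: Tate1967, §2.2] -/
theorem finrank_cotangent_fix_eq_finrank_range (G : Over (Spec (.of k))) [GrpObj G] [IsCommMonObj G] (ε : G ⟶ G) [IsMonHom ε] (hε : ε ≫ ε = ε) :
    letI := fixGrpObj ε
    Module.finrank k (RingHom.ker ((η[fix ε] : 𝟙_ (Over (Spec (.of k))) ⟶ _).left.appTop.hom) : Ideal (Alg (fix ε))).Cotangent =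
      Module.finrank k (LinearMap.range (Ideal.mapCotangent _ _ (Alg.comap ε) (ker_unit_le_comap ε))) := by
  letI := fixGrpObj ε
  haveI := isMonHom_fixι ε
  haveI := isMonHom_fixRetract ε hε
  exact finrank_cotangent_unit_eq_finrank_range_of_retract (fixι ε) (fixRetract ε hε) (fixι_fixRetract ε hε) ε (fixRetract_ι ε hε)

/-- **RANK ZERO ⇒ THE FIXED PART IS ÉTALE**: for a finite commutative group scheme `G` over `k = k̄` and an idempotent homomorphism `ε` whose cotangent map on
`cot(G)` has rank `0`, `Fix ε → Spec k` is étale (§1 + ★ `etale_of_finrank_cotangent_unit_eq_zero`). [cite: Tate1997FiniteFlatGroupSchemes, (3.7)]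
[cite: GortzWedhorn2020, (6.4) Proposition 6.7] -/
theorem etale_fix_of_finrank_range_mapCotangent_eq_zero [IsAlgClosed k] (G : Over (Spec (.of k))) [GrpObj G] [IsCommMonObj G] [IsFinite G.hom]
    (ε : G ⟶ G) [IsMonHom ε] (hε : ε ≫ ε = ε)
    (h0 : Module.finrank k (LinearMap.range (Ideal.mapCotangent _ _ (Alg.comap ε) (ker_unit_le_comap ε))) = 0) :
    Etale (fix ε).hom := by
  letI := fixGrpObj ε
  haveI : IsFinite (fix ε).hom := isFinite_fix_hom ε
  apply etale_of_finrank_cotangent_unit_eq_zero (fix ε)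
  rw [finrank_cotangent_fix_eq_finrank_range G ε hε]
  exact h0

end Fix

/-! ## §2 Two pins with the same points are isomorphic; étaleness of an abstract realisation of the block -/

section Readings

/-- **Two monomorphisms into `X` with the same `T`-points are isomorphic over `X`** (Yoneda; any category): the reading of a pin determines it up to a
unique isomorphism. [cite: GortzWedhorn2020, (6.4) Definition 6.2] -/
theorem exists_iso_of_readings {C : Type*} [Category C] {X G₁ G₂ : C} (j₁ : G₁ ⟶ X) (j₂ : G₂ ⟶ X) [Mono j₁] [Mono j₂]
    (h : ∀ ⦃T : C⦄ (t : T ⟶ X), (∃ s : T ⟶ G₁, s ≫ j₁ = t) ↔ ∃ s : T ⟶ G₂, s ≫ j₂ = t) :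
    ∃ e : G₁ ≅ G₂, e.hom ≫ j₂ = j₁ ∧ e.inv ≫ j₁ = j₂ := by
  obtain ⟨a, ha⟩ := (h j₁).1 ⟨𝟙 G₁, Category.id_comp _⟩
  obtain ⟨b, hb⟩ := (h j₂).2 ⟨𝟙 G₂, Category.id_comp _⟩
  refine ⟨⟨a, b, ?_, ?_⟩, ha, hb⟩
  · rw [← cancel_mono j₁, Category.assoc, hb, ha, Category.id_comp]
  · rw [← cancel_mono j₂, Category.assoc, ha, hb, Category.id_comp]

variable {k : Type u} [Field k]

/-- **ÉTALENESS OF ANY REALISATION OF THE BLOCK**: if `jW : W → G` is a monomorphism reading `x ≫ ε = x` on `T`-points (e.g. the `W` of ★ (α) `exists_fixedLayer`)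
and `Fix ε` is étale, then `W` is étale (`W ≅ Fix ε` over `G`, ★ `exists_comp_fixι_eq_iff`, ★ `etale_hom_of_iso`). [cite: Tate1997FiniteFlatGroupSchemes, (3.7)] -/
theorem etale_of_fix_reading {G W : Over (Spec (.of k))} [GrpObj G] (ε : G ⟶ G) (jW : W ⟶ G) [Mono jW]
    (hW : ∀ ⦃T : Over (Spec (.of k))⦄ (x : T ⟶ G), (∃ s : T ⟶ W, s ≫ jW = x) ↔ x ≫ ε = x) [Etale (fix ε).hom] : Etale W.hom := by
  haveI := mono_fixι ε
  obtain ⟨e, -, -⟩ := exists_iso_of_readings (fixι ε) jW (fun T x => by rw [exists_comp_fixι_eq_iff ε x, hW x])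
  exact etale_hom_of_iso e

end Readings

end Literature.AlgebraicGeometry.GroupSchemes

namespace Literature.AlgebraicGeometry.AbelianSchemes.AbelianSchemeOver

open Literature.AlgebraicGeometry.Motives Literature.AlgebraicGeometry.GroupSchemes Literature.AlgebraicGeometry.GroupSchemes.AffineGroupScheme
  Literature.AlgebraicGeometry.GroupSchemes.IdempotentSplitting Literature.AlgebraicGeometry.GroupSchemes.TorsionLayer

/-! ## §3 The torsion layer `A[N]`: ring-action calculus of `torsionMap`, and étale blocks from Lie rank zero -/

section Torsion

variable {k : Type u} [Field k] (𝒜 : AbelianSchemeOver (Spec (.of k))) [IsCommMonObj 𝒜.X]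

/-- **`torsionMap` is ADDITIVE for a ring action**: `(ι(a+b))[N] = (ι a)[N] · (ι b)[N]` (★ (α) `layerEnd_add` over the mono homomorphism `ι_{A[N]}`, ★
`torsionMap_ι`, ★ `RingAction.i_add`). [cite: Tate1967, §2.2] -/
theorem torsionMap_i_add {O : Type*} [CommRing O] (act : RingAction O 𝒜) (N : ℕ) (a b : O) :
    letI := 𝒜.torsionGrpObj N; haveI := act.isMonHom
    torsionMap (act.i (a + b)) N = torsionMap (act.i a) N * torsionMap (act.i b) N := by
  letI := 𝒜.torsionGrpObj N
  haveI := act.isMonHom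
  haveI := 𝒜.isMonHom_torsionι N
  haveI := 𝒜.mono_torsionι N
  exact layerEnd_add (𝒜.torsionι N) act.i (fun c => torsionMap (act.i c) N) (fun c => torsionMap_ι (act.i c) N) (act.i_add a b)

omit [IsCommMonObj 𝒜.X] in
/-- **`torsionMap` is MULTIPLICATIVE for a ring action**: `(ι(ab))[N] = (ι b)[N] ≫ (ι a)[N]` (★ (α) `layerEnd_mul`, ★ `RingAction.i_mul`). [cite: Tate1967, §2.2] -/
theorem torsionMap_i_mul {O : Type*} [CommRing O] (act : RingAction O 𝒜) (N : ℕ) (a b : O) :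
    haveI := act.isMonHom
    torsionMap (act.i (a * b)) N = torsionMap (act.i b) N ≫ torsionMap (act.i a) N := by
  haveI := act.isMonHom
  haveI := 𝒜.mono_torsionι N
  exact layerEnd_mul (𝒜.torsionι N) act.i (fun c => torsionMap (act.i c) N) (fun c => torsionMap_ι (act.i c) N) (act.i_mul a b)

/-- **A CRT IDEMPOTENT ACTS IDEMPOTENTLY ON `A[N]`**: `e * e = e + N • c ⟹ (ι e)[N] ≫ (ι e)[N] = (ι e)[N]` (★ (α) `layerEnd_idem_of_mul_self_eq`, `[N]_{A[N]} = 1` ★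
`id_pow_eq_one_torsion`). [cite: Tate1967, §2.2] [cite: RapoportSmithlingZhang2020Diagonal, §4.1 (p. 17)] -/
theorem torsionMap_i_idem_of_mul_self_eq {O : Type*} [CommRing O] (act : RingAction O 𝒜) (N : ℕ) {e c : O} (he : e * e = e + N • c) :
    haveI := act.isMonHom
    torsionMap (act.i e) N ≫ torsionMap (act.i e) N = torsionMap (act.i e) N := by
  letI := 𝒜.torsionGrpObj N
  haveI := act.isMonHom
  exact layerEnd_idem_of_mul_self_eq (fun c => torsionMap (act.i c) N) (fun a b => 𝒜.torsionMap_i_add act N a b)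
    (fun a b => 𝒜.torsionMap_i_mul act N a b) (𝒜.id_pow_eq_one_torsion N) he

/-- **LIE RANK ZERO ⇒ THE BLOCK OF `A[N]` IS ÉTALE.**  For an abelian scheme `𝒜` over `Spec k` (`k = k̄`), `N ≠ 0` with `N = 0` in `k`, and a homomorphism
`v : A → A` whose restriction `v[N]` to `A[N]` is idempotent: if the cotangent map of `v` on `𝔪_{A,e}∕𝔪_{A,e}²` is ZERO (rank `0`), then `Fix(v[N]) → Spec k` is
étale (★ DEAL 2 `finrank_range_mapCotangent_torsionMap_eq` + §1). [cite: Tate1967, §2.2] [cite: GortzWedhorn2020, (6.4) Proposition 6.7]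
[cite: Tate1997FiniteFlatGroupSchemes, (3.7)] -/
theorem etale_fix_torsionMap_of_finrank_range_cotangentMap_eq_zero [IsAlgClosed k] {N : ℕ} (hN : N ≠ 0) (hNk : (N : k) = 0)
    (v : 𝒜.X ⟶ 𝒜.X) [IsMonHom v] (hidem : torsionMap v N ≫ torsionMap v N = torsionMap v N)
    (h0 : Module.finrank k (LinearMap.range
      (AbelianVariety.cotangentMap 𝒜.toAffine.toAbelianVariety (InducedCategory.homMk (Grp.ofHom (A := 𝒜.X) (B := 𝒜.X) v)))) = 0) :
    letI := 𝒜.torsionGrpObj N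
    Etale (fix (torsionMap v N)).hom := by
  letI := 𝒜.torsionGrpObj N
  haveI := 𝒜.isCommMonObj_torsion N
  haveI := isMonHom_torsionMap v N
  haveI : IsFinite (𝒜.torsion N).hom := 𝒜.isFinite_torsion_hom hN
  apply etale_fix_of_finrank_range_mapCotangent_eq_zero (𝒜.torsion N) (torsionMap v N) hidem
  rw [finrank_range_mapCotangent_torsionMap_eq 𝒜 hN hNk v]
  exact h0

/-- **The blocks of `A[N]` are killed by `N`**: `(𝟙 (Fix v[N]))^N = 1` (★ `id_pow_eq_one_torsion` pulled back along `ι_Fix`, ★ (α) `pow_id_eq_one_of_layer`) — the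
`hq` input of the multiplicative law ★ `comp_comp_relFrobenius_eq_one_of_etale_cartierDual` at `N = p^r`. [cite: Tate1967, §2.2] -/
theorem id_pow_fix_torsionMap_eq_one (N : ℕ) (v : 𝒜.X ⟶ 𝒜.X) [IsMonHom v] :
    letI := 𝒜.torsionGrpObj N; haveI := 𝒜.isCommMonObj_torsion N; haveI := isMonHom_torsionMap v N; letI := fixGrpObj (torsionMap v N)
    (𝟙 (fix (torsionMap v N))) ^ N = 1 := by
  letI := 𝒜.torsionGrpObj N
  haveI := 𝒜.isCommMonObj_torsion N
  haveI := isMonHom_torsionMap v N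
  letI := fixGrpObj (torsionMap v N)
  haveI : IsMonHom (fixι (torsionMap v N)) := isMonHom_fixι _
  haveI := mono_fixι (torsionMap v N)
  exact pow_id_eq_one_of_layer (fixι (torsionMap v N)) (by rw [𝒜.id_pow_eq_one_torsion N, MonObj.comp_one])

end Torsion

/-! ## §4 Heads: the block of a CRT idempotent with Lie signature zero is étale, and the étale banal law on it -/

section Heads

variable {k : Type u} [Field k] [IsAlgClosed k] (𝒜 : AbelianSchemeOver (Spec (.of k))) [IsCommMonObj 𝒜.X]
  {O : Type*} [CommRing O] (act : RingAction O 𝒜) {N : ℕ} (hN : N ≠ 0) (hNk : (N : k) = 0) {e c : O} (he : e * e = e + N • c)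
  (hsig0 : haveI := act.isMonHom
    Module.finrank k (LinearMap.range
      (AbelianVariety.cotangentMap 𝒜.toAffine.toAbelianVariety (InducedCategory.homMk (Grp.ofHom (A := 𝒜.X) (B := 𝒜.X) (act.i e))))) = 0)

include hN hNk he hsig0 in
/-- **HEAD — A BANAL BLOCK OF SIGNATURE ZERO IS ÉTALE.**  `𝒜` an abelian scheme over `Spec k`, `k = k̄`, with a ring action `ι` of `O`; `N ≠ 0`, `N = 0` in
`k` (a power of the characteristic); `e ∈ O` a CRT idempotent modulo `N` (`e² = e + N c` — the `u`-block idempotent of `O ⧸ (N)`); Lie signature of `e`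
ZERO (`ι(e)^* = 0` on `𝔪_{A,e}∕𝔪_{A,e}²` — Kottwitz signature `0` at `u`, GEN's (S7)∕(U1-d) count).  Then the `u`-block `Fix((ι e)[N]) ⊂ A[N]` is ÉTALE over
`k`. [cite: RapoportSmithlingZhang2020Diagonal, §4.1 (p. 17)] [cite: Tate1967, §2.2] [cite: Tate1997FiniteFlatGroupSchemes, (3.7)] -/
theorem etale_block_of_lieSignature_zero :
    letI := 𝒜.torsionGrpObj N; haveI := act.isMonHom
    Etale (fix (torsionMap (act.i e) N)).hom := by
  haveI := act.isMonHom
  exact 𝒜.etale_fix_torsionMap_of_finrank_range_cotangentMap_eq_zero hN hNk (act.i e) (𝒜.torsionMap_i_idem_of_mul_self_eq act N he) hsig0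

include hN hNk he hsig0 in
/-- **HEAD — THE ÉTALE BANAL LAW ON THE BLOCK: `Ker F^{(r)}_{A∕k} ∩ Fix((ι e)[N]) = 1`.**  With the data of `etale_block_of_lieSignature_zero` and any `p`, `r`
(`k` of exponential characteristic `p`): a `T`-point `t` of the block satisfies `((t ≫ ι_Fix) ≫ ι_{A[N]}) ≫ F^{(r)}_{A∕k} = 1 ↔ t = 1` — the `law`
input of ★ (E2-asm) `AbelianVarietyKernelLawBlockAssembly` on an étale banal block, pin `Fix ↪ A[N] ↪ A` (★ (C1) FILE 1
`comp_comp_comp_relFrobenius_eq_one_iff_of_etale`). [cite: Tate1967, §2.2] [cite: Tate1997FiniteFlatGroupSchemes, (3.7)] [cite: RapoportSmithlingZhang2020Diagonal, §4.1 (p. 17)] -/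
theorem block_comp_relFrobenius_eq_one_iff_of_lieSignature_zero (p : ℕ) [ExpChar k p] (r : ℕ) {T : SchemeOver k}
    (t : letI := 𝒜.torsionGrpObj N; haveI := act.isMonHom; T ⟶ fix (torsionMap (act.i e) N)) :
    letI := 𝒜.torsionGrpObj N; haveI := act.isMonHom; haveI := 𝒜.isCommMonObj_torsion N; haveI := isMonHom_torsionMap (act.i e) N
    letI := fixGrpObj (torsionMap (act.i e) N)
    ((t ≫ fixι (torsionMap (act.i e) N)) ≫ 𝒜.torsionι N) ≫ (𝒜.toAffine.toAbelianVariety.relFrobenius p r).hom.hom.hom = 1 ↔ t = 1 := by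
  letI := 𝒜.torsionGrpObj N
  haveI := act.isMonHom
  haveI := 𝒜.isCommMonObj_torsion N
  haveI := isMonHom_torsionMap (act.i e) N
  haveI := 𝒜.isMonHom_torsionι N
  haveI := 𝒜.isClosedImmersion_torsionι_left N
  haveI : IsFinite (𝒜.torsion N).hom := 𝒜.isFinite_torsion_hom hN
  letI := fixGrpObj (torsionMap (act.i e) N)
  haveI : IsMonHom (fixι (torsionMap (act.i e) N)) := isMonHom_fixι (torsionMap (act.i e) N)
  haveI : IsClosedImmersion (fixι (torsionMap (act.i e) N)).left := isClosedImmersion_fixι_left _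
  haveI : Etale (fix (torsionMap (act.i e) N)).hom := 𝒜.etale_block_of_lieSignature_zero act hN hNk he hsig0
  exact AbelianVariety.comp_comp_comp_relFrobenius_eq_one_iff_of_etale p r 𝒜.toAffine.toAbelianVariety (𝒜.torsionι N)
    (fixι (torsionMap (act.i e) N)) t

end Heads

end Literature.AlgebraicGeometry.AbelianSchemes.AbelianSchemeOver

end
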